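import Mathlib.Topology.ContinuousMap.StoneWeierstrass
import Mathlib.MeasureTheory.Measure.Haar.Basic
import Mathlib.MeasureTheory.Group.Integral
import Mathlib.MeasureTheory.Function.L2Space
import Mathlib.Analysis.InnerProductSpace.Projection.Basic
import Mathlib.RepresentationTheory.Continuous.Basic
import Mathlib.LinearAlgebra.FiniteDimensional.Lemmas
import Mathlib.LinearAlgebra.Dual.Lemmas
import Mathlib.Topology.Algebra.Module.FiniteDimension
import Literature.NumberTheory.Automorphic.GodementJacquetZetaIntegrals
import Literature.NumberTheory.Automorphic.AdelicGLnGlueProofs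
import Literature.NumberTheory.Automorphic.AutomorphicSpectrumProofs
import Literature.NumberTheory.Automorphic.UnramifiedHeckeScalars
import Literature.NumberTheory.Automorphic.IntegratedOperator
import HarnessLib

/-!
# `K`-finite vectors in Hilbert representations of compact groups, and cusp forms in `Π^{K(𝔫)}`

Topic `NumberTheory/Automorphic`; definitions (`leftTranslate` (= Mathlib's `coind₁` of the trivial
representation, `leftTranslate_eq_coind₁`), `IsTranslationFinite`,
`translationFiniteSubalgebra`, `smear`, `coordFun`, `rightRegularKinf`) and theorems; companion of
`IntegratedOperator` (whose `ContRepresentation.integratedOperator` is the same operator for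
unitary `π`, `smear_eq_integratedOperator`).

**Abstract part (compact groups).** Let `G` be a compact group, `μ` a left Haar measure on `G`
and `π` a strongly continuous representation of `G` on a complex Hilbert space `H`. For
`ψ ∈ C(G, ℂ)` the *smeared vector* `π(ψ) v = ∫_G ψ(g) π(g) v dμ(g)` (`smear`, a Bochner integral)
satisfies `π(g₀) π(ψ) v = π(λ(g₀) ψ) v` with `λ(g₀) ψ = ψ(g₀⁻¹ ·)` (`apply_smear`), so that
`π(ψ) v` is `G`-finite as soon as `ψ` is a *representative* (`G`-finite, `IsTranslationFinite`)
function (`finiteDimensional_span_orbit_smear`; Bröcker–tom Dieck, III (5.6)). The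
`G`-finite functions form a star subalgebra of `C(G, ℂ)` (`translationFiniteSubalgebra`,
Bröcker–tom Dieck, III §1); when it separates points it is dense by the Stone–Weierstrass
theorem (Mathlib `ContinuousMap.starSubalgebra_topologicalClosure_eq_top_of_separatesPoints`;
this is the proof of the Peter–Weyl theorem III (3.1) for matrix groups given in
Bröcker–tom Dieck, p. 126 of the PDF, and III (4.3)), and then **every `v ≠ 0` has a non-zero
`G`-finite smear** (`exists_isTranslationFinite_smear_ne_zero`): `ψ ↦ π(ψ) v` is continuous for
the uniform norm and `⟪v, π(ψ₀) v⟫ = ∫ |⟪v, π(g) v⟫|² dμ > 0` for `ψ₀ = conj ⟪v, π(·) v⟫`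
(`smear_conj_inner_ne_zero`). This is the existence half of Bröcker–tom Dieck, III (5.7)
(finite-dimensional `G`-subspaces generate a dense subspace), proved here without compact
operators. For a subgroup `S` of a real matrix group `GL_m(A)` (`A` a finite-dimensional real
topological algebra) the real coordinates of the matrix entries are `S`-finite and separate
points (`isTranslationFinite_coordFun`, `separatesPoints_translationFiniteSubalgebra`).

**Application (`GL_n` over a number field).** For the regular representation `R` of
`GL_n(𝔸_K)` on `L² = L²(GL_n(K) A_G ∖ GL_n(𝔸_K), μ)` restricted to the compact matrix group
`K_∞ = Kinf n K ≤ GL_n(K_∞)` (`rightRegularKinf`; strongly continuous by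
`isStronglyContinuous_rightRegular_holds`), a closed subrepresentation `Π = W` (e.g. a cuspidal
automorphic representation), a level `U ∈ finiteLevelsGL n K` and `0 ≠ φ₀ ∈ Π^U`, the smear
`φ = R(ψ) φ₀` for a suitable `K_∞`-finite `ψ` is a **non-zero `K`-finite vector of `Π` of level
`U`** (`exists_isKFiniteVector_of_mem_fixed`, for any closed subrepresentation `W` in place of
`Π`): it lies in `Π` (closed and `R`-stable,
`smear_mem_of_isClosed`), is `U`-fixed (`U` commutes with `K_∞`,
`GLn.commute_ofInfinite_ofFinite`, `apply_smear_of_commute`) and is `K_∞`-finite in the sense of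
`IsKFiniteVector` (`GodementJacquetZetaIntegrals`) / `kFiniteVectors` (`GKModules`). With the
existence of a level (`exists_fixedVectors_principalCongruenceLevel_ne_bot`, proved in
`UnramifiedHeckeScalarsProofs`) every cuspidal `Π` has a non-zero `K`-finite vector fixed by some
`K(𝔫)` (`exists_isKFiniteVector_principalCongruenceLevel`): the cusp forms of `Π` in the sense
of Borel–Jacquet (1979), §4.6 are non-zero.

Purpose: the global Godement–Jacquet facts (`GodementJacquet1972_gjZeta_meromorphic`,
`GodementJacquet1972_gjZeta_eulerFactorisation`) are stated for `K`-finite vectors; this file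
supplies such vectors inside `Π^{K(𝔫)}` for the `K^T`-spherical unfolding of the zeta integral
(decomposition of `godementJacquet_hasMeromorphicContinuation`, lang.S21).

## Design notes

* The abstract part assumes only `[CompactSpace G]`, a Borel structure and a measure finite on
  compacts (left-invariant / positive on opens where needed); no second countability (the
  integrands are continuous with compact support, hence strongly measurable).
* Relation to the topic's established integrated operator: `ContRepresentation.integratedOperator`
  (`IntegratedOperator.lean`, `π(f) v = ∫ f(g) • π(g) v dη` for `f ∈ C_c(G)`, a bounded operator,
  defined for *unitary* `π`) is the survivor notion; `smear π μ ψ v` is the same Bochner integral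
  for `ψ ∈ C(G) = C_c(G)` (`G` compact) without the unitarity needed to bundle it as a bounded
  operator — the abstract existence theorem below uses only strong continuity and compactness.
  The bridge `smear_eq_integratedOperator` (`rfl`) records the identification for unitary `π`
  (e.g. `rightRegular`, `isUnitary_rightRegular`), so the two cannot drift apart; the lemmas kept
  here (`apply_smear`, `continuous_smear`, `inner_smear`, `apply_smear_of_commute`,
  `smear_conj_inner_ne_zero`, `finiteDimensional_span_orbit_smear`,
  `exists_isTranslationFinite_smear_ne_zero`) are the ones `IntegratedOperator` does not have;
  `smear_mem_of_isClosed` is `integratedOperator_apply_mem` minus unitarity.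
* `smear` is stated for `[InnerProductSpace ℂ H]`; consumers should not unfold it in contexts
  where `H` carries an independent real normed-space structure (e.g. `Lp`), and the `GL_n`
  application accordingly only uses the abstract lemmas.
* Strong continuity is the tree's `ContRepresentation.IsStronglyContinuous`
  (`HilbertRepSpectrum`).
* `leftTranslate g ψ = ψ(g⁻¹ ·)` is Mathlib's `(ContRepresentation.trivial ℂ G ℂ).coind₁ g ψ` (the
  left regular representation on `C(G, ℂ)`, survivor notion; bridge `leftTranslate_eq_coind₁`,
  `rfl`); the local name is kept for readability of the `G`-finiteness statements.
* `rightRegularKinf μ` is the restriction of `rightRegularArch μ` (`GodementJacquetZetaIntegrals`)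
  along `Subgroup.inclusion (archGroupGL n K).maximalCompact_le_carrier`
  (`rightRegularKinf_apply_eq_rightRegularArch`, `rfl`), which is why `mem_kFiniteVectors_iff`
  (stated for `rightRegularArch`) applies to it.
* Nothing here is specific to cuspidality: `exists_isKFiniteVector_of_mem_fixed` holds for every
  closed subrepresentation of `L²` containing the given `U`-fixed vector.

## References

* T. Bröcker, T. tom Dieck, *Representations of Compact Lie Groups*, GTM 98 (1985), Ch. III:
  §1 (representative functions), Thm. (3.1) (Peter–Weyl) with the Stone–Weierstrass proof for
  matrix groups (p. 126 of the PDF) and (4.3), Cor. (5.6), Thm. (5.7) (pp. 126–131 of the PDF,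
  read) [BrockerTomDieck1985].
* A. Borel, H. Jacquet, *Automorphic forms and automorphic representations*, Corvallis (1979),
  Part 1, §4.6 (`K`-finite vectors, cusp forms in `L²`) [BorelJacquet1979].
* G. B. Folland, *A Course in Abstract Harmonic Analysis* (1995), §3.2 (integrated
  representation), §5.2 [Folland1995].
-/

noncomputable section

open MeasureTheory ContinuousMap Complex NumberField NumberField.mixedEmbedding IsDedekindDomain
open scoped MatrixGroups
open scoped InnerProductSpace ComplexConjugate Pointwise

namespace Literature.NumberTheory.Automorphic

section CompactGroup

variable {G : Type*} [TopologicalSpace G] [Group G] [IsTopologicalGroup G]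

/-- The left translate `(λ(g) ψ)(x) = ψ(g⁻¹ x)` of a continuous function on a topological group
(the left regular representation of `G` on `C(G, ℂ)`; Folland (1995), §2.2). [folklore] -/
def leftTranslate (g : G) (ψ : C(G, ℂ)) : C(G, ℂ) :=
  ψ.comp ⟨fun x => g⁻¹ * x, by fun_prop⟩

/-- Unfolding the left translate. [folklore] -/
@[simp]
theorem leftTranslate_apply (g : G) (ψ : C(G, ℂ)) (x : G) :
    leftTranslate g ψ x = ψ (g⁻¹ * x) := rfl

/-- **Bridge to Mathlib's left regular representation.** `leftTranslate g` *is* the operator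
`(ContRepresentation.trivial ℂ G ℂ).coind₁ g` of Mathlib's continuous coinduced representation
(`Mathlib.RepresentationTheory.Continuous.Basic`, `coind₁_apply_apply : π.coind₁ g f x = π g (f (g⁻¹ * x))`),
the bundled left regular representation of `G` on `C(G, ℂ)` — the survivor notion; `leftTranslate`
is kept as a readable local name and the action laws come from `map_one`/`map_mul` of `coind₁`
(definitional). [folklore] -/
theorem leftTranslate_eq_coind₁ (g : G) (ψ : C(G, ℂ)) :
    leftTranslate g ψ = (ContRepresentation.trivial ℂ G ℂ).coind₁ g ψ := rfl

/-- `λ(1) = id` (from `map_one` of `coind₁`). [folklore] -/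
theorem leftTranslate_one (ψ : C(G, ℂ)) : leftTranslate (1 : G) ψ = ψ := by
  rw [leftTranslate_eq_coind₁, map_one]
  rfl

/-- `λ(g h) = λ(g) ∘ λ(h)` (from `map_mul` of `coind₁`). [folklore] -/
theorem leftTranslate_mul_left (g h : G) (ψ : C(G, ℂ)) :
    leftTranslate (g * h) ψ = leftTranslate g (leftTranslate h ψ) := by
  rw [leftTranslate_eq_coind₁, leftTranslate_eq_coind₁, leftTranslate_eq_coind₁, map_mul]
  rfl

/-- `λ(g)` is additive. [folklore] -/
theorem leftTranslate_add (g : G) (ψ₁ ψ₂ : C(G, ℂ)) :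
    leftTranslate g (ψ₁ + ψ₂) = leftTranslate g ψ₁ + leftTranslate g ψ₂ := rfl

/-- `λ(g)` commutes with scalars. [folklore] -/
theorem leftTranslate_smul (g : G) (c : ℂ) (ψ : C(G, ℂ)) :
    leftTranslate g (c • ψ) = c • leftTranslate g ψ := rfl

/-- `λ(g)` is multiplicative. [folklore] -/
theorem leftTranslate_mul (g : G) (ψ₁ ψ₂ : C(G, ℂ)) :
    leftTranslate g (ψ₁ * ψ₂) = leftTranslate g ψ₁ * leftTranslate g ψ₂ := rfl

/-- `λ(g)` commutes with complex conjugation. [folklore] -/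
theorem leftTranslate_star (g : G) (ψ : C(G, ℂ)) :
    leftTranslate g (star ψ) = star (leftTranslate g ψ) := rfl

/-- `λ(g) 1 = 1`. [folklore] -/
theorem leftTranslate_one' (g : G) : leftTranslate g (1 : C(G, ℂ)) = 1 := rfl

/-- `λ(g)` fixes the constants. [folklore] -/
theorem leftTranslate_algebraMap (g : G) (c : ℂ) :
    leftTranslate g (algebraMap ℂ C(G, ℂ) c) = algebraMap ℂ C(G, ℂ) c := rfl

/-- `ψ ∈ C(G, ℂ)` is **`G`-finite** (translation-finite): its left translates lie in a
finite-dimensional subspace (equivalently, span a finite-dimensional subspace) — the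
representative functions of `G` (Bröcker–tom Dieck (1985), III §1; Folland (1995), §5.2). [folklore] -/
def IsTranslationFinite (ψ : C(G, ℂ)) : Prop :=
  ∃ F : Submodule ℂ C(G, ℂ), FiniteDimensional ℂ F ∧ ∀ g : G, leftTranslate g ψ ∈ F

/-- `0` is `G`-finite. [folklore] -/
theorem IsTranslationFinite.zero : IsTranslationFinite (0 : C(G, ℂ)) :=
  ⟨⊥, inferInstance, fun _ => (Submodule.mem_bot ℂ).2 rfl⟩

/-- Sums of `G`-finite functions are `G`-finite. [folklore] -/
theorem IsTranslationFinite.add {ψ₁ ψ₂ : C(G, ℂ)} (h₁ : IsTranslationFinite ψ₁)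
    (h₂ : IsTranslationFinite ψ₂) : IsTranslationFinite (ψ₁ + ψ₂) := by
  obtain ⟨F₁, hF₁, h₁⟩ := h₁
  obtain ⟨F₂, hF₂, h₂⟩ := h₂
  exact ⟨F₁ ⊔ F₂, inferInstance, fun g => Submodule.add_mem_sup (h₁ g) (h₂ g)⟩

/-- Scalar multiples of `G`-finite functions are `G`-finite. [folklore] -/
theorem IsTranslationFinite.smul {ψ : C(G, ℂ)} (c : ℂ) (h : IsTranslationFinite ψ) :
    IsTranslationFinite (c • ψ) := by
  obtain ⟨F, hF, h⟩ := h
  exact ⟨F, hF, fun g => F.smul_mem c (h g)⟩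

/-- Constants are `G`-finite. [folklore] -/
theorem IsTranslationFinite.const (c : ℂ) :
    IsTranslationFinite (algebraMap ℂ C(G, ℂ) c) :=
  ⟨Submodule.span ℂ {algebraMap ℂ C(G, ℂ) c}, inferInstance,
    fun _ => Submodule.subset_span rfl⟩

/-- Products of `G`-finite functions are `G`-finite: the translates of `ψ₁ ψ₂` lie in the span of
the pairwise products of finite spanning sets (Bröcker–tom Dieck, III §1). [folklore] -/
theorem IsTranslationFinite.mul {ψ₁ ψ₂ : C(G, ℂ)} (h₁ : IsTranslationFinite ψ₁)
    (h₂ : IsTranslationFinite ψ₂) : IsTranslationFinite (ψ₁ * ψ₂) := by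
  obtain ⟨F₁, hF₁, h₁⟩ := h₁
  obtain ⟨F₂, hF₂, h₂⟩ := h₂
  obtain ⟨s₁, hs₁⟩ := (Submodule.fg_iff_finiteDimensional F₁).2 hF₁
  obtain ⟨s₂, hs₂⟩ := (Submodule.fg_iff_finiteDimensional F₂).2 hF₂
  refine ⟨Submodule.span ℂ ((s₁ : Set C(G, ℂ)) * (s₂ : Set C(G, ℂ))), ?_, fun g => ?_⟩
  · exact FiniteDimensional.span_of_finite ℂ ((s₁.finite_toSet).mul s₂.finite_toSet)
  · rw [← Submodule.span_mul_span, leftTranslate_mul]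
    exact Submodule.mul_mem_mul (hs₁ ▸ h₁ g) (hs₂ ▸ h₂ g)

omit [Group G] [IsTopologicalGroup G] in
/-- Complex conjugation maps `span s` into `span (star s)` (conjugate-linearity). [folklore] -/
theorem star_mem_span_star {s : Set C(G, ℂ)} {ψ : C(G, ℂ)} (h : ψ ∈ Submodule.span ℂ s) :
    star ψ ∈ Submodule.span ℂ (star s) := by
  induction h using Submodule.span_induction with
  | mem x hx => exact Submodule.subset_span (Set.star_mem_star.2 hx)
  | zero => rw [star_zero]; exact Submodule.zero_mem _
  | add x y _ _ hx hy => rw [star_add]; exact Submodule.add_mem _ hx hy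
  | smul c x _ hx => rw [star_smul]; exact Submodule.smul_mem _ _ hx

/-- Complex conjugates of `G`-finite functions are `G`-finite (Bröcker–tom Dieck, III §1).
[folklore] -/
theorem IsTranslationFinite.star {ψ : C(G, ℂ)} (h : IsTranslationFinite ψ) :
    IsTranslationFinite (star ψ) := by
  obtain ⟨F, hF, h⟩ := h
  obtain ⟨s, hs⟩ := (Submodule.fg_iff_finiteDimensional F).2 hF
  refine ⟨Submodule.span ℂ (Star.star (s : Set C(G, ℂ))), ?_, fun g => ?_⟩
  · exact FiniteDimensional.span_of_finite ℂ s.finite_toSet.star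
  · rw [leftTranslate_star]
    exact star_mem_span_star (hs ▸ h g)

variable (G) in
/-- The **star subalgebra of `G`-finite functions** in `C(G, ℂ)` (representative functions):
closed under sums, products, scalars and complex conjugation (Bröcker–tom Dieck (1985), III §1;
Folland (1995), §5.2). [folklore] -/
def translationFiniteSubalgebra : StarSubalgebra ℂ C(G, ℂ) where
  carrier := {ψ | IsTranslationFinite ψ}
  mul_mem' h₁ h₂ := h₁.mul h₂
  one_mem' := by simpa using IsTranslationFinite.const (G := G) 1
  add_mem' h₁ h₂ := h₁.add h₂
  zero_mem' := IsTranslationFinite.zero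
  algebraMap_mem' c := IsTranslationFinite.const c
  star_mem' h := h.star

/-- Membership in `translationFiniteSubalgebra` (definitional). [folklore] -/
theorem mem_translationFiniteSubalgebra {ψ : C(G, ℂ)} :
    ψ ∈ translationFiniteSubalgebra G ↔ IsTranslationFinite ψ := Iff.rfl

end CompactGroup

/-! ### Smearing a vector by a continuous function: `π(ψ) v = ∫ ψ(g) π(g) v dg` -/

section Smear

variable {G : Type*} [TopologicalSpace G] [Group G] [MeasurableSpace G]
  {H : Type*} [NormedAddCommGroup H] [InnerProductSpace ℂ H]

/-- The **smeared vector** `π(ψ) v = ∫_G ψ(g) π(g) v dμ(g)` of `v` by a continuous function `ψ`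
on the group `G` (a Bochner integral in the Hilbert space `H`; Folland (1995), §3.2, the
integrated form of a representation; Bröcker–tom Dieck (1985), III §5). [folklore] -/
def smear (π : ContRepresentation ℂ G H) (μ : Measure G) (ψ : C(G, ℂ)) (v : H) : H :=
  ∫ g, ψ g • π g v ∂μ

/-- Unfolding `smear`. [folklore] -/
theorem smear_def (π : ContRepresentation ℂ G H) (μ : Measure G) (ψ : C(G, ℂ)) (v : H) :
    smear π μ ψ v = ∫ g, ψ g • π g v ∂μ := rfl

/-- **Bridge to the topic's integrated operator.** For a unitary, strongly continuous `π` and a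
measure finite on compacts, `smear π μ ψ v` *is* `π(ψ) v` in the sense of
`ContRepresentation.integratedOperator` (`IntegratedOperator.lean`), `ψ ∈ C(G) = C_c(G)` for
compact `G` (definitional). [folklore] -/
theorem smear_eq_integratedOperator [OpensMeasurableSpace G] [CompactSpace G] [CompleteSpace H]
    {π : ContRepresentation ℂ G H} (hu : π.IsUnitary) (hc : π.IsStronglyContinuous) (μ : Measure G)
    [IsFiniteMeasureOnCompacts μ] (ψ : C(G, ℂ)) (v : H) :
    smear π μ ψ v = π.integratedOperator hu hc μ ⟨ψ, HasCompactSupport.of_compactSpace ψ⟩ v :=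
  rfl

omit [MeasurableSpace G] in
/-- The integrand `g ↦ ψ(g) π(g) v` is continuous for a strongly continuous `π`. [folklore] -/
theorem continuous_smul_orbit {π : ContRepresentation ℂ G H}
    (hπ : π.IsStronglyContinuous) (ψ : C(G, ℂ)) (v : H) :
    Continuous fun g : G => ψ g • π g v :=
  ψ.continuous.smul (hπ v)

omit [MeasurableSpace G] in
/-- Orbits of a strongly continuous representation of a compact group are bounded. [folklore] -/
theorem exists_norm_orbit_le [CompactSpace G] {π : ContRepresentation ℂ G H}
    (hπ : π.IsStronglyContinuous) (v : H) :
    ∃ C : ℝ, 0 ≤ C ∧ ∀ g : G, ‖π g v‖ ≤ C := by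
  obtain ⟨C, hC⟩ := isCompact_univ.exists_bound_of_continuousOn (f := fun g : G => π g v)
    (hπ v).continuousOn
  exact ⟨max C 0, le_max_right _ _, fun g => (hC g (Set.mem_univ g)).trans (le_max_left _ _)⟩

variable [CompactSpace G] [BorelSpace G]
  {π : ContRepresentation ℂ G H} {μ : Measure G} [IsFiniteMeasureOnCompacts μ]

/-- The integrand `g ↦ ψ(g) π(g) v` is integrable (continuous on a compact group, finite Haar
measure). [folklore] -/
theorem integrable_smul_orbit (hπ : π.IsStronglyContinuous) (ψ : C(G, ℂ))
    (v : H) : Integrable (fun g : G => ψ g • π g v) μ :=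
  (continuous_smul_orbit hπ ψ v).integrable_of_hasCompactSupport
    (HasCompactSupport.of_compactSpace _)

/-- `ψ ↦ π(ψ) v` is additive. [folklore] -/
theorem smear_add (hπ : π.IsStronglyContinuous) (ψ₁ ψ₂ : C(G, ℂ)) (v : H) :
    smear π μ (ψ₁ + ψ₂) v = smear π μ ψ₁ v + smear π μ ψ₂ v := by
  simp only [smear_def, ContinuousMap.add_apply, add_smul]
  exact integral_add (integrable_smul_orbit hπ ψ₁ v) (integrable_smul_orbit hπ ψ₂ v)

omit [CompactSpace G] [BorelSpace G] [IsFiniteMeasureOnCompacts μ] in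
/-- `ψ ↦ π(ψ) v` is homogeneous. [folklore] -/
theorem smear_smul (c : ℂ) (ψ : C(G, ℂ)) (v : H) :
    smear π μ (c • ψ) v = c • smear π μ ψ v := by
  simp only [smear_def, ContinuousMap.smul_apply, smul_eq_mul, mul_smul]
  exact integral_smul c _

variable (π μ) in
/-- `ψ ↦ π(ψ) v` as a `ℂ`-linear map `C(G, ℂ) → H`. [folklore] -/
def smearₗ (hπ : π.IsStronglyContinuous) (v : H) : C(G, ℂ) →ₗ[ℂ] H where
  toFun ψ := smear π μ ψ v
  map_add' ψ₁ ψ₂ := smear_add hπ ψ₁ ψ₂ v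
  map_smul' c ψ := smear_smul c ψ v

/-- Unfolding `smearₗ`. [folklore] -/
@[simp]
theorem smearₗ_apply (hπ : π.IsStronglyContinuous) (v : H) (ψ : C(G, ℂ)) :
    smearₗ π μ hπ v ψ = smear π μ ψ v := rfl

omit [BorelSpace G] in
/-- **Norm bound** `‖π(ψ) v‖ ≤ C μ(G) ‖ψ‖_∞` for any bound `C` of the orbit of `v`. [folklore] -/
theorem norm_smear_le (v : H) {C : ℝ} (hC : ∀ g : G, ‖π g v‖ ≤ C) (ψ : C(G, ℂ)) :
    ‖smear π μ ψ v‖ ≤ C * μ.real Set.univ * ‖ψ‖ := by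
  haveI : IsFiniteMeasure μ := CompactSpace.isFiniteMeasure
  have h : ∀ᵐ g ∂μ, ‖ψ g • π g v‖ ≤ ‖ψ‖ * C := Filter.Eventually.of_forall fun g => by
    rw [_root_.norm_smul]
    exact mul_le_mul (ψ.norm_coe_le_norm g) (hC g) (norm_nonneg _) (norm_nonneg _)
  calc ‖smear π μ ψ v‖ ≤ ‖ψ‖ * C * μ.real Set.univ := norm_integral_le_of_norm_le_const h
    _ = C * μ.real Set.univ * ‖ψ‖ := by ring

/-- `ψ ↦ π(ψ) v` is continuous for the uniform norm on `C(G, ℂ)`. [folklore] -/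
theorem continuous_smear (hπ : π.IsStronglyContinuous) (v : H) :
    Continuous fun ψ : C(G, ℂ) => smear π μ ψ v := by
  obtain ⟨C, -, hC⟩ := exists_norm_orbit_le hπ v
  exact AddMonoidHomClass.continuous_of_bound (smearₗ π μ hπ v) (C * μ.real Set.univ)
    fun ψ => norm_smear_le v hC ψ

variable [CompleteSpace H]

/-- **Equivariance of smearing**: `π(g₀) π(ψ) v = π(λ(g₀) ψ) v` for a left-invariant measure
(substitute `g ↦ g₀ g`; Bröcker–tom Dieck (1985), III (5.5): `g (u * a) = (g · u) * a` with
`(g · u)(x) = u(g⁻¹ x)`; Folland (1995), §3.2). [cite: BrockerTomDieck1985, III (5.5)] -/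
theorem apply_smear [IsTopologicalGroup G] [μ.IsMulLeftInvariant]
    (hπ : π.IsStronglyContinuous) (g₀ : G) (ψ : C(G, ℂ)) (v : H) :
    π g₀ (smear π μ ψ v) = smear π μ (leftTranslate g₀ ψ) v := by
  rw [smear_def, ← (π g₀).integral_comp_comm (integrable_smul_orbit hπ ψ v), smear_def]
  simp only [ContinuousLinearMap.map_smul, leftTranslate_apply]
  rw [← integral_mul_left_eq_self (fun g => ψ (g₀⁻¹ * g) • π g v) g₀]
  refine integral_congr_ae (Filter.Eventually.of_forall fun g => ?_)
  simp only [inv_mul_cancel_left, map_mul]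
  rfl

/-- **Smearing by a `G`-finite function yields a `G`-finite vector**: if the translates of `ψ`
lie in a finite-dimensional space, so do the `π(g) π(ψ) v = π(λ(g) ψ) v`
(Bröcker–tom Dieck (1985), III Cor. (5.6)). [cite: BrockerTomDieck1985, III (5.6)] -/
theorem finiteDimensional_span_orbit_smear [IsTopologicalGroup G] [μ.IsMulLeftInvariant]
    (hπ : π.IsStronglyContinuous) {ψ : C(G, ℂ)} (hψ : IsTranslationFinite ψ)
    (v : H) :
    FiniteDimensional ℂ (Submodule.span ℂ (Set.range fun g : G => π g (smear π μ ψ v))) := by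
  obtain ⟨F, hF, hψF⟩ := hψ
  refine Submodule.finiteDimensional_of_le (S₂ := F.map (smearₗ π μ hπ v))
    (Submodule.span_le.2 ?_)
  rintro _ ⟨g, rfl⟩
  exact ⟨leftTranslate g ψ, hψF g, (apply_smear hπ g ψ v).symm⟩

/-- `⟪w, π(ψ) v⟫ = ∫ ψ(g) ⟪w, π(g) v⟫ dμ(g)` (the inner product commutes with the Bochner
integral, Mathlib `integral_inner`). [folklore] -/
theorem inner_smear (hπ : π.IsStronglyContinuous) (ψ : C(G, ℂ)) (v w : H) :
    ⟪w, smear π μ ψ v⟫_ℂ = ∫ g, ψ g * ⟪w, π g v⟫_ℂ ∂μ := by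
  rw [smear_def, ← integral_inner (integrable_smul_orbit hπ ψ v)]
  simp only [inner_smul_right]

/-- **Operators commuting with `π(G)` act on smears through their action on the vector**: if
`T π(g) = π(g) T` for all `g` then `T π(ψ) v = π(ψ) (T v)`; in particular `T` fixes `π(ψ) v`
when it fixes `v` (used for the level operators `R(u)`, `u` finite-adelic, which commute with
`K_∞`). [folklore] -/
theorem apply_smear_of_commute (hπ : π.IsStronglyContinuous) (T : H →L[ℂ] H)
    (hT : ∀ (g : G) (w : H), T (π g w) = π g (T w)) (ψ : C(G, ℂ)) (v : H) :
    T (smear π μ ψ v) = smear π μ ψ (T v) := by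
  rw [smear_def, ← T.integral_comp_comm (integrable_smul_orbit hπ ψ v), smear_def]
  simp only [ContinuousLinearMap.map_smul, hT]

/-- **Smears stay in closed invariant subspaces**: if `S ≤ H` is closed and `π(G)`-stable and
`v ∈ S` then `π(ψ) v ∈ S` (test against `Sᗮ`: `⟪w, π(ψ) v⟫ = ∫ ψ ⟪w, π(g) v⟫ = 0` for `w ⊥ S`,
and `Sᗮᗮ = S` for closed `S`, Mathlib `Submodule.orthogonal_orthogonal`). [folklore] -/
theorem smear_mem_of_isClosed (hπ : π.IsStronglyContinuous)
    {S : Submodule ℂ H} (hS : IsClosed (S : Set H)) (hinv : ∀ (g : G), ∀ w ∈ S, π g w ∈ S)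
    (ψ : C(G, ℂ)) {v : H} (hv : v ∈ S) : smear π μ ψ v ∈ S := by
  haveI : CompleteSpace S := hS.completeSpace_coe
  rw [← Submodule.orthogonal_orthogonal S, Submodule.mem_orthogonal]
  intro w hw
  rw [inner_smear hπ]
  refine integral_eq_zero_of_ae (Filter.Eventually.of_forall fun g => ?_)
  simp only [Pi.zero_apply]
  rw [Submodule.inner_left_of_mem_orthogonal (hinv g v hv) hw, mul_zero]

/-- **Non-degeneracy of smearing.** For `v ≠ 0` the function `ψ₀(g) = conj ⟪v, π(g) v⟫` has
`⟪v, π(ψ₀) v⟫ = ∫ |⟪v, π(g) v⟫|² dμ > 0` (the integrand is continuous, non-negative and equals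
`‖v‖⁴ > 0` at `g = 1`; a Haar measure charges open sets), so `π(ψ₀) v ≠ 0`. [folklore] -/
theorem smear_conj_inner_ne_zero [μ.IsOpenPosMeasure]
    (hπ : π.IsStronglyContinuous) {v : H} (hv : v ≠ 0) :
    smear π μ ⟨fun g => conj ⟪v, π g v⟫_ℂ, (continuous_conj.comp
      (continuous_const.inner (hπ v)))⟩ v ≠ 0 := by
  intro h0
  have h1 := inner_smear (μ := μ) hπ ⟨fun g => conj ⟪v, π g v⟫_ℂ, (continuous_conj.comp
      (continuous_const.inner (hπ v)))⟩ v v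
  rw [h0, inner_zero_right] at h1
  simp only [ContinuousMap.coe_mk, Complex.conj_mul'] at h1
  have h2 : (0 : ℝ) < ∫ g, ‖⟪v, π g v⟫_ℂ‖ ^ 2 ∂μ := by
    refine Continuous.integral_pos_of_hasCompactSupport_nonneg_nonzero (μ := μ) (x := 1)
      ((continuous_const.inner (hπ v)).norm.pow 2) (HasCompactSupport.of_compactSpace _)
      (fun g => sq_nonneg _) ?_
    rw [map_one]
    exact pow_ne_zero _ (norm_ne_zero_iff.2 (inner_self_ne_zero.2 hv))
  simp only [← Complex.ofReal_pow] at h1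
  rw [integral_complex_ofReal] at h1
  exact h2.ne' (Complex.ofReal_eq_zero.1 h1.symm)

/-- **Existence of non-zero `G`-finite vectors (Peter–Weyl by Stone–Weierstrass).** Let `π` be a
strongly continuous representation of the compact group `G` on a Hilbert
space, and suppose the `G`-finite continuous functions separate the points of `G` (true for
compact groups of matrices: matrix entries are `G`-finite). Then every `v ≠ 0` has a non-zero
`G`-finite smear `π(ψ) v`, `ψ` `G`-finite: by the Stone–Weierstrass theorem (Mathlib
`ContinuousMap.starSubalgebra_topologicalClosure_eq_top_of_separatesPoints`) the star subalgebra
of `G`-finite functions is dense in `C(G, ℂ)`; `ψ ↦ π(ψ) v` is continuous and does not vanish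
at `ψ₀ = conj ⟪v, π(·) v⟫` (`smear_conj_inner_ne_zero`), hence does not vanish identically on
the dense subalgebra (Bröcker–tom Dieck (1985), III: Cor. (5.6), Thm. (5.7) — density of the
finite-dimensional `G`-subspaces, there via the Peter–Weyl theorem III (3.1); here only existence,
by the Stone–Weierstrass argument of III §3, p. 126, and (4.3)).
[cite: BrockerTomDieck1985, III (5.6)–(5.7)] -/
theorem exists_isTranslationFinite_smear_ne_zero [IsTopologicalGroup G] [μ.IsOpenPosMeasure]
    [μ.IsMulLeftInvariant] (hπ : π.IsStronglyContinuous)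
    (hsep : (translationFiniteSubalgebra G).SeparatesPoints) {v : H} (hv : v ≠ 0) :
    ∃ ψ : C(G, ℂ), IsTranslationFinite ψ ∧ smear π μ ψ v ≠ 0 ∧
      FiniteDimensional ℂ (Submodule.span ℂ (Set.range fun g : G => π g (smear π μ ψ v))) := by
  by_contra hcon
  have hzero : ∀ ψ ∈ translationFiniteSubalgebra G, smear π μ ψ v = 0 := by
    intro ψ hψ
    by_contra hne
    exact hcon ⟨ψ, hψ, hne, finiteDimensional_span_orbit_smear hπ hψ v⟩
  have hdense : Dense ((translationFiniteSubalgebra G : StarSubalgebra ℂ C(G, ℂ)) :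
      Set C(G, ℂ)) := by
    rw [dense_iff_closure_eq, ← StarSubalgebra.topologicalClosure_coe,
      ContinuousMap.starSubalgebra_topologicalClosure_eq_top_of_separatesPoints _ hsep]
    rfl
  have hall : (fun ψ : C(G, ℂ) => smear π μ ψ v) = fun _ => 0 :=
    Continuous.ext_on hdense (continuous_smear hπ v) continuous_const fun ψ hψ => hzero ψ hψ
  exact smear_conj_inner_ne_zero hπ hv (congrFun hall _)

end Smear

/-! ### Compact matrix groups: matrix coefficients are `G`-finite and separate points -/

section MatrixGroups

variable {A : Type*} [Ring A] [TopologicalSpace A] [IsTopologicalRing A] [Algebra ℝ A]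
  [ContinuousSMul ℝ A] [FiniteDimensional ℝ A] [T2Space A]
  {m : Type*} [Fintype m] [DecidableEq m] (S : Subgroup (GL m A))

/-- The **coordinate functions** `k ↦ ℓ(k) ∈ ℝ ⊂ ℂ` on a subgroup `S ≤ GL_m(A)` of a real
matrix group, for a real linear functional `ℓ` on `M_m(A)` (e.g. a real coordinate of a matrix
entry): the polynomial functions of degree one (Bröcker–tom Dieck (1985), III §1 and §3, p. 126).
[folklore] -/
def coordFun (ℓ : Matrix m m A →ₗ[ℝ] ℝ) : C(S, ℂ) where
  toFun k := (ℓ ((k : GL m A) : Matrix m m A) : ℂ)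
  continuous_toFun := Complex.continuous_ofReal.comp
    (ℓ.continuous_of_finiteDimensional.comp (Units.continuous_val.comp continuous_subtype_val))

/-- Unfolding `coordFun`. [folklore] -/
@[simp]
theorem coordFun_apply (ℓ : Matrix m m A →ₗ[ℝ] ℝ) (k : S) :
    coordFun S ℓ k = (ℓ ((k : GL m A) : Matrix m m A) : ℂ) := rfl

/-- `ℓ ↦ coordFun S ℓ` is `ℝ`-linear. [folklore] -/
def coordFunₗ : (Matrix m m A →ₗ[ℝ] ℝ) →ₗ[ℝ] C(S, ℂ) where
  toFun := coordFun S
  map_add' ℓ₁ ℓ₂ := by ext k; simp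
  map_smul' c ℓ := by ext k; simp

/-- Unfolding `coordFunₗ`. [folklore] -/
@[simp]
theorem coordFunₗ_apply (ℓ : Matrix m m A →ₗ[ℝ] ℝ) : coordFunₗ S ℓ = coordFun S ℓ := rfl

/-- **Left translates of coordinate functions are coordinate functions**:
`ℓ(k₀⁻¹ k) = (ℓ ∘ L_{k₀⁻¹})(k)` with `L_M` left multiplication by the matrix `M`, a real linear
map of `M_m(A)`. [folklore] -/
theorem leftTranslate_coordFun (k₀ : S) (ℓ : Matrix m m A →ₗ[ℝ] ℝ) :
    leftTranslate k₀ (coordFun S ℓ) =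
      coordFun S (ℓ ∘ₗ LinearMap.mulLeft ℝ (((k₀⁻¹ : S) : GL m A) : Matrix m m A)) := by
  ext k
  simp [Units.val_mul]

/-- **Coordinate functions are `G`-finite**: their translates lie in the (finite-dimensional)
complex span of the coordinate functions of a basis of the real dual of `M_m(A)`
(Bröcker–tom Dieck (1985), III §1: matrix coefficients of a finite-dimensional representation are
representative functions). [folklore] -/
theorem isTranslationFinite_coordFun (ℓ : Matrix m m A →ₗ[ℝ] ℝ) :
    IsTranslationFinite (coordFun S ℓ) := by
  let b := Module.finBasis ℝ (Matrix m m A →ₗ[ℝ] ℝ)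
  refine ⟨Submodule.span ℂ (Set.range fun i => coordFun S (b i)),
    FiniteDimensional.span_of_finite ℂ (Set.finite_range _), fun k₀ => ?_⟩
  rw [leftTranslate_coordFun]
  set ℓ' := ℓ ∘ₗ LinearMap.mulLeft ℝ (((k₀⁻¹ : S) : GL m A) : Matrix m m A)
  rw [← b.sum_repr ℓ', ← coordFunₗ_apply, map_sum]
  refine Submodule.sum_mem _ fun i _ => ?_
  rw [LinearMap.map_smul, coordFunₗ_apply, ← Complex.coe_smul]
  exact Submodule.smul_mem _ _ (Submodule.subset_span ⟨i, rfl⟩)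

/-- **The `G`-finite functions separate the points of a matrix group** (already the coordinate
functions do: two distinct matrices differ in some real coordinate). This is the hypothesis of
the Stone–Weierstrass step in `exists_isTranslationFinite_smear_ne_zero` (Bröcker–tom Dieck
(1985), III (4.3): the algebra generated by the matrix coefficients `r_{ij}`, `conj r_{ij}` of a
faithful representation is dense in `C(G, ℂ)`). [cite: BrockerTomDieck1985, III (4.3)] -/
theorem separatesPoints_translationFiniteSubalgebra [IsTopologicalGroup S] :
    (translationFiniteSubalgebra S).SeparatesPoints := by
  intro x y hxy
  have hne : ((x : GL m A) : Matrix m m A) - ((y : GL m A) : Matrix m m A) ≠ 0 :=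
    sub_ne_zero.2 fun h => hxy (Subtype.ext (Units.ext h))
  obtain ⟨ℓ, hℓ⟩ := not_forall.1 (mt (Module.forall_dual_apply_eq_zero_iff ℝ _).1 hne)
  refine ⟨coordFun S ℓ, ⟨coordFun S ℓ, isTranslationFinite_coordFun S ℓ, rfl⟩, fun h => hℓ ?_⟩
  have h' : ((ℓ ((x : GL m A) : Matrix m m A) : ℝ) : ℂ) = ℓ ((y : GL m A) : Matrix m m A) := h
  rw [map_sub, Complex.ofReal_injective h', sub_self]

end MatrixGroups

/-! ### `K_∞`-finite vectors in cuspidal automorphic representations of `GL_n(𝔸_K)` -/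

section GLn

variable {n : ℕ} {K : Type} [Field K] [NumberField K]
  (μ : Measure (AdelicGroupData.gl n K).automorphicQuotient)
  [(AdelicGroupData.gl n K).IsAutomorphicMeasure μ]

/-- The regular representation `R` of `GL_n(𝔸_K)` on `L²(GL_n(K) A_G ∖ GL_n(𝔸_K))` restricted to
the maximal compact subgroup `K_∞ = ∏_{w real} O(n) × ∏_{w complex} U(n)` of the archimedean
group (`Kinf n K`, embedded by `GLn.ofInfinite`; Mathlib `ContRepresentation.restrict`).
Borel–Jacquet (1979), §4.6. [folklore] -/
def rightRegularKinf : ContRepresentation ℂ (Kinf n K) ((AdelicGroupData.gl n K).L2 μ) :=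
  ((AdelicGroupData.gl n K).rightRegular μ).restrict
    ((GLn.ofInfinite n K).comp (Kinf n K).subtype)

variable {μ}

/-- `rightRegularKinf μ k = R(ofInfinite k)` (definitional). [folklore] -/
@[simp]
theorem rightRegularKinf_apply (k : Kinf n K) :
    rightRegularKinf μ k = (AdelicGroupData.gl n K).rightRegular μ (GLn.ofInfinite n K k) := rfl

open scoped Classical in
/-- `rightRegularKinf μ k = rightRegularArch μ (inclusion k)`: the restriction to `K_∞` is the
restriction of `rightRegularArch` (`GodementJacquetZetaIntegrals`) along
`K_∞ = (archGroupGL n K).maximalCompact ≤ (archGroupGL n K).carrier` (definitional; this is the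
defeq through which `mem_kFiniteVectors_iff` applies). [folklore] -/
theorem rightRegularKinf_apply_eq_rightRegularArch (k : Kinf n K) :
    rightRegularKinf μ k =
      rightRegularArch μ (Subgroup.inclusion (archGroupGL n K).maximalCompact_le_carrier k) := rfl

/-- The restriction of `R` to `K_∞` is strongly continuous (`R` is,
`isStronglyContinuous_rightRegular_holds`, and `K_∞ → GL_n(𝔸_K)` is continuous,
`GLn.continuous_ofInfinite`). [folklore] -/
theorem isStronglyContinuous_rightRegularKinf : (rightRegularKinf μ).IsStronglyContinuous :=
  fun v => ((AdelicGroupData.gl n K).isStronglyContinuous_rightRegular_holds μ v).comp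
    ((GLn.continuous_ofInfinite n K).comp continuous_subtype_val)

/-- The restriction of `R` to `K_∞` is unitary (`isUnitary_rightRegular`). [folklore] -/
theorem isUnitary_rightRegularKinf : (rightRegularKinf μ).IsUnitary :=
  fun k => (AdelicGroupData.gl n K).isUnitary_rightRegular μ (GLn.ofInfinite n K k)

/-- A level `U ∈ finiteLevelsGL n K` (a subgroup `{1} × U₀` of the finite-adelic group)
commutes with the archimedean group: `R(u) R(ofInfinite k) = R(ofInfinite k) R(u)`
(`GLn.commute_ofInfinite_ofFinite`). [folklore] -/
theorem rightRegular_comm_of_mem_finiteLevelsGL {U : Subgroup (GL (Fin n) (AdeleRing (𝓞 K) K))}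
    (hU : U ∈ finiteLevelsGL n K) {u : GL (Fin n) (AdeleRing (𝓞 K) K)} (hu : u ∈ U)
    (k : GL (Fin n) (mixedSpace K)) (v : (AdelicGroupData.gl n K).L2 μ) :
    (AdelicGroupData.gl n K).rightRegular μ u
        ((AdelicGroupData.gl n K).rightRegular μ (GLn.ofInfinite n K k) v) =
      (AdelicGroupData.gl n K).rightRegular μ (GLn.ofInfinite n K k)
        ((AdelicGroupData.gl n K).rightRegular μ u v) := by
  obtain ⟨U₀, -, -, rfl⟩ := hU
  obtain ⟨u₀, -, rfl⟩ := hu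
  set a : (AdelicGroupData.gl n K).Adelic := GLn.ofInfinite n K k
  set b : (AdelicGroupData.gl n K).Adelic := GLn.ofFinite n K u₀
  have hab : a * b = b * a := (GLn.commute_ofInfinite_ofFinite (n := n) (K := K) k u₀).eq
  have h := congrArg ((AdelicGroupData.gl n K).rightRegular μ) hab
  rw [map_mul, map_mul] at h
  exact DFunLike.congr_fun h.symm v

/-- **Closed subrepresentations of `L²` contain non-zero `K`-finite vectors of every level they
have.** Let `W ≤ L²(GL_n(K) A_G ∖ GL_n(𝔸_K))` be a closed `R`-stable subspace (e.g. a cuspidal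
automorphic representation, or a residual one), `U ∈ finiteLevelsGL n K` a level and
`0 ≠ φ₀ ∈ W^U`. Then `W` contains a non-zero `U`-fixed vector `φ` which is `K`-finite
(`IsKFiniteVector`: `U`-fixed and `K_∞`-finite), namely `φ = R(ψ) φ₀ = ∫_{K_∞} ψ(k) R(k) φ₀ dk` for
a suitable `K_∞`-finite `ψ ∈ C(K_∞, ℂ)` (`exists_isTranslationFinite_smear_ne_zero` for the
compact matrix group `K_∞`, whose coordinate functions separate points;
`R(ψ) φ₀ ∈ W` because `W` is closed and `R`-stable — test against `Wᗮ` — and `R(ψ) φ₀` is `U`-fixed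
because `U` commutes with `K_∞`). This is the classical statement that the `K`-finite vectors
(automorphic forms) are dense in, in particular non-zero in, `W^U` (Borel–Jacquet (1979), §4.6;
Harish-Chandra; Getz–Hahn (2024), Lemma 5.3.3 and §6.3); here only existence is recorded.
[cite: BorelJacquet1979, §4.6] -/
theorem exists_isKFiniteVector_of_mem_fixed
    (W : ContRepresentation.ClosedSubrep ((AdelicGroupData.gl n K).rightRegular μ))
    {U : Subgroup (GL (Fin n) (AdeleRing (𝓞 K) K))} (hU : U ∈ finiteLevelsGL n K)
    {φ₀ : (AdelicGroupData.gl n K).L2 μ} (hφ₀P : φ₀ ∈ W) (hφ₀ : φ₀ ≠ 0)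
    (hfix : ∀ u ∈ U, (AdelicGroupData.gl n K).rightRegular μ u φ₀ = φ₀) :
    ∃ φ : (AdelicGroupData.gl n K).L2 μ, φ ∈ W ∧ φ ≠ 0 ∧
      (∀ u ∈ U, (AdelicGroupData.gl n K).rightRegular μ u φ = φ) ∧ IsKFiniteVector μ φ := by
  classical
  haveI : CompactSpace (Kinf n K) := isCompact_iff_compactSpace.mp (isCompact_Kinf_holds n K)
  letI : MeasurableSpace (Kinf n K) := borel _
  haveI : BorelSpace (Kinf n K) := ⟨rfl⟩
  have hπ := isStronglyContinuous_rightRegularKinf (μ := μ)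
  obtain ⟨ψ, -, hne, hfin⟩ := exists_isTranslationFinite_smear_ne_zero
    (π := rightRegularKinf μ) (μ := Measure.haar) hπ
    (separatesPoints_translationFiniteSubalgebra (Kinf n K)) hφ₀
  have hfixφ : ∀ u ∈ U, (AdelicGroupData.gl n K).rightRegular μ u
      (smear (rightRegularKinf μ) Measure.haar ψ φ₀) =
        smear (rightRegularKinf μ) Measure.haar ψ φ₀ := by
    intro u hu
    rw [apply_smear_of_commute hπ ((AdelicGroupData.gl n K).rightRegular μ u)
      (fun k w => rightRegular_comm_of_mem_finiteLevelsGL hU hu k w) ψ φ₀, hfix u hu]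
  refine ⟨smear (rightRegularKinf μ) Measure.haar ψ φ₀, ?_, hne, hfixφ, ⟨U, hU, hfixφ⟩, ?_⟩
  · exact smear_mem_of_isClosed hπ (S := W.toSubmodule) W.isClosed
      (fun k w hw => W.apply_mem _ hw) ψ hφ₀P
  · rw [mem_kFiniteVectors_iff]
    exact hfin

/-- **Every cuspidal automorphic representation of `GL_n(𝔸_K)` has a non-zero `K`-finite vector
fixed by a principal congruence subgroup**: combine the existence of a level
(`exists_fixedVectors_principalCongruenceLevel_ne_bot`, proved in `UnramifiedHeckeScalarsProofs` as
`exists_fixedVectors_principalCongruenceLevel_ne_bot_holds`, fed here as the hypothesis `hlev` to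
keep imports short), the admissibility of `K(𝔫)` as a level
(`principalCongruenceLevel_mem_finiteLevelsGL`, hypothesis `hpc`, proved as
`principalCongruenceLevel_mem_finiteLevelsGL_holds` in `GLnCuspidalSpectrumSiegel` — so the corollary
is unconditional once both `_holds` theorems are supplied) and
`exists_isKFiniteVector_of_mem_fixed` (Borel–Jacquet (1979), §4.6: cuspidal automorphic
representations are generated by cusp forms). [cite: BorelJacquet1979, §4.6] -/
theorem exists_isKFiniteVector_principalCongruenceLevel
    (hlev : exists_fixedVectors_principalCongruenceLevel_ne_bot (n := n) (K := K) (μ := μ))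
    (hpc : principalCongruenceLevel_mem_finiteLevelsGL n K) (P : CuspidalAutomorphicRepGL n K μ) :
    ∃ (𝔫 : Ideal (𝓞 K)) (φ : (AdelicGroupData.gl n K).L2 μ), 𝔫 ≠ 0 ∧ φ ∈ P.1 ∧ φ ≠ 0 ∧
      (∀ u ∈ principalCongruenceLevel n K 𝔫, (AdelicGroupData.gl n K).rightRegular μ u φ = φ) ∧
        IsKFiniteVector μ φ := by
  obtain ⟨𝔫, h𝔫, hbot⟩ := hlev P
  obtain ⟨f, hf, hf0⟩ := (Submodule.ne_bot_iff _).1 hbot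
  have hf0' : (f : (AdelicGroupData.gl n K).L2 μ) ≠ 0 := fun h => hf0 (Subtype.ext h)
  have hfix : ∀ u ∈ principalCongruenceLevel n K 𝔫,
      (AdelicGroupData.gl n K).rightRegular μ u f = f := fun u hu => by
    have := (ContRepresentation.ClosedSubrep.mem_fixedVectors _ _ _).1 hf u hu
    exact congrArg Subtype.val this
  obtain ⟨φ, hφP, hφ0, hφfix, hφK⟩ :=
    exists_isKFiniteVector_of_mem_fixed P.1 (hpc h𝔫) f.2 hf0' hfix
  exact ⟨𝔫, φ, h𝔫, hφP, hφ0, hφfix, hφK⟩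

end GLn

end Literature.NumberTheory.Automorphic
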